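import Mathlib
import Literature.NumberTheory.Sieve.Maynard2016IntervalPrimes
import HarnessLib

/-!
# Maynard 2016, Lemma 7: the primes of `𝓘_m ⊆ [x/2, x]`, upper count

Topic `Literature/NumberTheory/Sieve`. J. Maynard, *Large gaps between primes*, Ann. of Math. (2)
183 (2016), 915–933 = arXiv:1408.5110, §6, proof of Lemma 7: "Since `𝓘_m` is contained in
`[x/2, x]`, the number of primes in `𝓘_m` is `(1 + o(1))|𝓘_m|/log x` by the prime number theorem"
— the `o(1)` is two-sided; the lower count is `eventually_card_intervalPrimes_ge`
(`Maynard2016IntervalPrimes`), and the upper count (used for the error and `a ≠ 1` contributions,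
displays (6.29)–(6.31)) is proved here in the same shape: for `x/2 ≤ A`, `B ≤ x`,
`B − A ≥ x/(log x)^n`: `#{q prime : A ≤ q ≤ B} ≤ (1 + κ)(B − A)/log x` for all large `x`.

PROVED here (no named facts): `card_intervalPrimes_le_card_Ioc_add_one`,
`card_Ioc_mul_log_le_theta_sub`, `eventually_card_intervalPrimes_le`.

## References

* J. Maynard, *Large gaps between primes*, Ann. of Math. (2) 183 (2016), 915–933; arXiv:1408.5110,
  Lemma 7 (proof). [Maynard2016LargeGaps]
* H. L. Montgomery, R. C. Vaughan, *Multiplicative Number Theory I*, CUP 2007, §2.2, Cor. 2.5 and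
  §6.2 (the prime number theorem with de la Vallée Poussin's error term). [MontgomeryVaughan2007]
-/

open Filter Finset Asymptotics
open scoped Topology

namespace Literature.NumberTheory.Sieve

namespace Maynard2016

/-- `#{q prime : A ≤ q ≤ B} ≤ #{p prime : ⌊A⌋ < p ≤ ⌊B⌋} + 1` (the only possible extra element is
`⌊A⌋ = A` itself). [cite: Maynard2016LargeGaps, Lemma 7 (definition of 𝓘_m)] -/
theorem card_intervalPrimes_le_card_Ioc_add_one (A B : ℝ) :
    (intervalPrimes A B).card ≤ ((Finset.Ioc ⌊A⌋₊ ⌊B⌋₊).filter Nat.Prime).card + 1 := by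
  classical
  have hsub : intervalPrimes A B ⊆ insert ⌊A⌋₊ ((Finset.Ioc ⌊A⌋₊ ⌊B⌋₊).filter Nat.Prime) := by
    intro p hp
    unfold intervalPrimes at hp
    simp only [Finset.mem_filter, Finset.mem_Icc] at hp
    rw [Finset.mem_insert, Finset.mem_filter, Finset.mem_Ioc]
    rcases lt_or_ge ⌊A⌋₊ p with h | h
    · exact Or.inr ⟨⟨h, hp.1.2⟩, hp.2⟩
    · exact Or.inl (le_antisymm h ((Nat.floor_le_ceil A).trans hp.1.1))
  exact (Finset.card_le_card hsub).trans (Finset.card_insert_le _ _)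

/-- `#{p prime : ⌊A⌋ < p ≤ ⌊B⌋} · log A ≤ ϑ(B) − ϑ(A)` for `1 ≤ A ≤ B`. [cite: MontgomeryVaughan2007, §2.2 (definition of ϑ)] -/
theorem card_Ioc_mul_log_le_theta_sub {A B : ℝ} (hA : 1 ≤ A) (hAB : A ≤ B) :
    (((Finset.Ioc ⌊A⌋₊ ⌊B⌋₊).filter Nat.Prime).card : ℝ) * Real.log A ≤
      Chebyshev.theta B - Chebyshev.theta A := by
  rw [theta_sub_theta_eq hAB]
  have hA0 : 0 < A := by linarith
  calc (((Finset.Ioc ⌊A⌋₊ ⌊B⌋₊).filter Nat.Prime).card : ℝ) * Real.log A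
      = ∑ p ∈ (Finset.Ioc ⌊A⌋₊ ⌊B⌋₊).filter Nat.Prime, Real.log A := by
        rw [Finset.sum_const, nsmul_eq_mul]
    _ ≤ ∑ p ∈ (Finset.Ioc ⌊A⌋₊ ⌊B⌋₊).filter Nat.Prime, Real.log p := by
        refine Finset.sum_le_sum fun p hp => ?_
        simp only [Finset.mem_filter, Finset.mem_Ioc] at hp
        refine Real.log_le_log hA0 ?_
        have h1 : A < ⌊A⌋₊ + 1 := Nat.lt_floor_add_one A
        have h2 : ((⌊A⌋₊ + 1 : ℕ) : ℝ) ≤ p := by exact_mod_cast hp.1.1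
        push_cast at h2
        linarith

/-- **The number of primes in `𝓘_m` (upper count).** For every `n` and `κ > 0`, for all large `x`:
if `x/2 ≤ A`, `B ≤ x` and `B − A ≥ x/(log x)^n` then `#{q prime : A ≤ q ≤ B} ≤ (1 + κ)(B − A)/log x`.
[cite: Maynard2016LargeGaps, Lemma 7 (proof, «the number of primes in 𝓘_m is (1+o(1))|𝓘_m|/log x»)] -/
theorem eventually_card_intervalPrimes_le (n : ℕ) {κ : ℝ} (hκ : 0 < κ) :
    ∀ᶠ x : ℕ in atTop, ∀ A B : ℝ, (x : ℝ) / 2 ≤ A → B ≤ x → (x : ℝ) / Real.log x ^ n ≤ B - A →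
      ((intervalPrimes A B).card : ℝ) ≤ (1 + κ) * ((B - A) / Real.log x) := by
  obtain ⟨C, hC0, hC⟩ :=
    Literature.NumberTheory.LFunctions.Mertens.exists_abs_theta_sub_le_div_log_pow (n + 2)
  have hκ3 : 0 < κ / 3 := by positivity
  have hT : Tendsto (fun X : ℝ => κ / 3 * (Real.log X) ^ 2) atTop atTop :=
    ((tendsto_pow_atTop two_ne_zero).comp Real.tendsto_log_atTop).const_mul_atTop hκ3
  have ho : ∀ᶠ X : ℝ in atTop, ‖Real.log X ^ (n + 1)‖ ≤ κ / 3 * ‖id X‖ :=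
    (Real.isLittleO_pow_log_id_atTop (n := n + 1)).bound hκ3
  have hreal : ∀ᶠ X : ℝ in atTop, 4 ≤ X ∧ (1 + 2 * κ / 3) * Real.log 2 ≤ κ / 3 * Real.log X ∧
      2 ^ (n + 3) * C ≤ κ / 3 * Real.log X ^ 2 ∧ Real.log X ^ (n + 1) ≤ κ / 3 * X := by
    filter_upwards [eventually_ge_atTop 4,
      (Real.tendsto_log_atTop.const_mul_atTop hκ3).eventually_ge_atTop ((1 + 2 * κ / 3) * Real.log 2),
      hT.eventually_ge_atTop (2 ^ (n + 3) * C), ho] with X h1 h2 h3 h4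
    refine ⟨h1, h2, h3, ?_⟩
    have hl : 0 ≤ Real.log X := Real.log_nonneg (by linarith)
    rw [Real.norm_of_nonneg (pow_nonneg hl _), id, Real.norm_of_nonneg (by linarith)] at h4
    exact h4
  filter_upwards [tendsto_natCast_atTop_atTop.eventually hreal] with x hx
  obtain ⟨hx4, hlog2, hbig, hpow⟩ := hx
  intro A B hA hB hBA
  set L := Real.log x with hLdef
  have hl2 : 0 < Real.log 2 := Real.log_pos one_lt_two
  have hL0 : 0 < L := by nlinarith
  have hxpos : (0 : ℝ) < x := by linarith
  have hA2 : 2 ≤ A := by linarith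
  have hD0 : 0 ≤ B - A := le_trans (by positivity) hBA
  have hAB : A ≤ B := by linarith
  -- `log A ≥ L − log 2`
  have hlogA : L - Real.log 2 ≤ Real.log A := by
    have h1 : Real.log (x / 2) ≤ Real.log A := Real.log_le_log (by positivity) hA
    rw [Real.log_div hxpos.ne' two_ne_zero] at h1
    linarith
  have hM0 : 0 < L - Real.log 2 := by nlinarith
  -- the error at any `t ∈ [A, B]` (as in the lower count)
  have hlogA' : L / 2 ≤ Real.log A := by
    have : 2 * Real.log 2 ≤ L := by nlinarith
    linarith
  have herr : ∀ t : ℝ, A ≤ t → t ≤ B →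
      |Chebyshev.theta t - t| ≤ C * x / (L / 2) ^ (n + 2) := by
    intro t h1 h2
    refine (hC t (by linarith)).trans ?_
    have hlt : L / 2 ≤ Real.log t := hlogA'.trans (Real.log_le_log (by linarith) h1)
    have hL2pos : 0 < L / 2 := by linarith
    have hlogt : 0 < Real.log t := lt_of_lt_of_le hL2pos hlt
    calc C * t / Real.log t ^ (n + 2) ≤ C * x / Real.log t ^ (n + 2) :=
          div_le_div_of_nonneg_right (mul_le_mul_of_nonneg_left (h2.trans hB) hC0)
            (pow_nonneg hlogt.le _)
      _ ≤ C * x / (L / 2) ^ (n + 2) :=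
          div_le_div_of_nonneg_left (by positivity) (pow_pos hL2pos _)
            (pow_le_pow_left₀ hL2pos.le hlt _)
  have hθ : Chebyshev.theta B - Chebyshev.theta A ≤
      (B - A) + 2 * (C * x / (L / 2) ^ (n + 2)) := by
    have h1 := herr A le_rfl hAB
    have h2 := herr B hAB le_rfl
    rw [abs_le] at h1 h2
    linarith [h1.1, h1.2, h2.1, h2.2]
  have hsmall : 2 * (C * x / (L / 2) ^ (n + 2)) ≤ κ / 3 * (B - A) := by
    have e : 2 * (C * x / (L / 2) ^ (n + 2)) = (2 ^ (n + 3) * C) * x / L ^ (n + 2) := by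
      rw [div_pow]
      field_simp
      ring
    rw [e]
    calc (2 ^ (n + 3) * C) * x / L ^ (n + 2) ≤ (κ / 3 * L ^ 2) * x / L ^ (n + 2) :=
          div_le_div_of_nonneg_right (mul_le_mul_of_nonneg_right hbig hxpos.le) (pow_nonneg hL0.le _)
      _ = κ / 3 * ((x : ℝ) / L ^ n) := by
          field_simp
          ring
      _ ≤ κ / 3 * (B - A) := mul_le_mul_of_nonneg_left hBA hκ3.le
  -- `N (L − log 2) ≤ (1 + κ/3)(B − A)` for the number `N` of primes in `(⌊A⌋, ⌊B⌋]`
  set N : ℝ := (((Finset.Ioc ⌊A⌋₊ ⌊B⌋₊).filter Nat.Prime).card : ℝ) with hNdef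
  have hN0 : 0 ≤ N := Nat.cast_nonneg _
  have hN1 : N * (L - Real.log 2) ≤ (1 + κ / 3) * (B - A) := by
    have h1 : N * (L - Real.log 2) ≤ N * Real.log A := mul_le_mul_of_nonneg_left hlogA hN0
    have h2 := card_Ioc_mul_log_le_theta_sub (by linarith : (1 : ℝ) ≤ A) hAB
    linarith
  -- hence `N L ≤ (1 + 2κ/3)(B − A)`
  have hN2 : N * L ≤ (1 + 2 * κ / 3) * (B - A) := by
    have hN : N ≤ (1 + κ / 3) * (B - A) / (L - Real.log 2) := by
      rw [le_div_iff₀ hM0]; exact hN1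
    have hNl : N * Real.log 2 ≤ κ / 3 * (B - A) := by
      calc N * Real.log 2 ≤ (1 + κ / 3) * (B - A) / (L - Real.log 2) * Real.log 2 :=
            mul_le_mul_of_nonneg_right hN hl2.le
        _ ≤ κ / 3 * (B - A) := by
            rw [div_mul_eq_mul_div, div_le_iff₀ hM0]
            nlinarith [mul_le_mul_of_nonneg_left hlog2 hD0]
    nlinarith
  -- and `L ≤ (κ/3)(B − A)` (for the `+1`)
  have hone : L ≤ κ / 3 * (B - A) := by
    have h1 : L * L ^ n ≤ κ / 3 * x := by rw [← pow_succ']; exact hpow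
    have h2 : L ≤ κ / 3 * ((x : ℝ) / L ^ n) := by
      rw [mul_div_assoc', le_div_iff₀ (pow_pos hL0 n)]; exact h1
    exact h2.trans (mul_le_mul_of_nonneg_left hBA hκ3.le)
  -- assemble
  have hI : ((intervalPrimes A B).card : ℝ) ≤ N + 1 := by
    have := card_intervalPrimes_le_card_Ioc_add_one A B
    rw [hNdef]; exact_mod_cast this
  rw [show (1 + κ) * ((B - A) / L) = ((1 + κ) * (B - A)) / L by ring, le_div_iff₀ hL0]
  nlinarith

end Maynard2016

end Literature.NumberTheory.Sieve
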